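import Summits.QuantumAdvantage.QuantumAdvantage.Theorems.CubicForrelationNearExactIsExactCubicEvenOnFourFlat

/-!
# Crux `CubicForrelation.NearExactIsExact` (stmt-QuantumAdvantage-14043), line `direct-sum-amplification`,
  stub `stub_flatPartitionDistance` — soundness of the flat-partition distance certificates

Soundness of the `f`-side certificates of the `n = 10` census.  A certificate for a word
`t : 𝔽₂⁹ → 𝔽₂` consists of `32` four-dimensional cubes
`pt k ε := b k ⊕ Σ_{εᵢ = 1} u k i` (`k : Fin 32`, `ε ∈ 𝔽₂⁴`) whose points are pairwise distinct across
different `k` and on each of which `t` has ODD parity.  Then every cubic `F` (algebraic degree `≤ 3`)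
differs from `t` in at least `32` points, i.e. `dist(t, RM(3,9)) ≥ 32`.

Proof.  Fix `k`.  By the landed `stub_cubicEvenOnFourFlat` (applied to `F`, `b k`, `u k`) the number of
`ε` with `F (pt k ε) = 1` is even, while the number of `ε` with `t (pt k ε) = 1` is odd; so the two
filters differ and there is `ε_k` with `F (pt k ε_k) ≠ t (pt k ε_k)` (`fp_exists_ne_of_even_odd`).
The map `k ↦ pt k ε_k` is injective by the distinctness hypothesis and its image lies in
`{x | F x ≠ t x}`, whence `32 = |Fin 32| ≤ |{x | F x ≠ t x}|` (`fp_card_le_filter_ne`).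

References: F. J. MacWilliams, N. J. A. Sloane, *The Theory of Error-Correcting Codes* (1977), Ch. 13 §3
(Reed–Muller codes, minimum distance via flats).  Everything is proved from the tree
(`stub_cubicEvenOnFourFlat`) and Mathlib's `Finset` cardinality lemmas; axioms are the standard three.
-/

set_option linter.dupNamespace false -- D-0017: single-problem summit ⇒ `QuantumAdvantage.QuantumAdvantage` by design

noncomputable section

namespace Summit.QuantumAdvantage.QuantumAdvantage.Theorems.CubicForrelation.NearExactIsExact

open Finset
open Literature.Computability.QuantumComplexity

/-! ### Two Boolean predicates of different parity differ somewhere -/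

/-- If the supports of two Boolean functions on a finite type have cardinalities of different parity
(one even, one odd), then the two functions differ at some point: otherwise the two filters coincide
(`Finset.filter_congr`) and so do their cardinalities. -/
theorem fp_exists_ne_of_even_odd {α : Type*} [Fintype α] {f g : α → Bool}
    (hf : Even ((univ.filter fun a => f a = true).card))
    (hg : Odd ((univ.filter fun a => g a = true).card)) :
    ∃ a, f a ≠ g a := by
  by_contra h
  push Not at h
  have hfg : (univ.filter fun a => f a = true) = (univ.filter fun a => g a = true) :=
    Finset.filter_congr fun a _ => by rw [h a]
  rw [hfg] at hf
  exact (Nat.not_even_iff_odd.mpr hg) hf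

/-! ### Counting: one mismatch per block, blocks point-disjoint -/

/-- **Block counting.**  Let `pt : ι → κ → X` be a family of blocks (`k ↦ {pt k ε | ε}`) whose points are
pairwise distinct across different block indices `k`, and suppose every block contains a point where
the Boolean functions `F` and `t` disagree.  Then `F` and `t` disagree in at least `|ι|` points: choosing
one mismatch `ε_k` per block, `k ↦ pt k ε_k` is injective (`Finset.card_image_of_injective`) with image
inside the mismatch filter (`Finset.card_le_card`). -/
theorem fp_card_le_filter_ne {ι κ X : Type*} [Fintype ι] [Fintype X] [DecidableEq X]
    (pt : ι → κ → X) (F t : X → Bool)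
    (hinj : ∀ (k k' : ι) (ε ε' : κ), pt k ε = pt k' ε' → k = k')
    (hex : ∀ k : ι, ∃ ε : κ, F (pt k ε) ≠ t (pt k ε)) :
    Fintype.card ι ≤ (univ.filter fun x : X => F x ≠ t x).card := by
  choose e he using hex
  have hinj' : Function.Injective fun k => pt k (e k) := fun k k' h => hinj k k' (e k) (e k') h
  calc Fintype.card ι = (univ.image fun k => pt k (e k)).card := by
        rw [card_image_of_injective _ hinj', card_univ]
    _ ≤ (univ.filter fun x : X => F x ≠ t x).card := by
        refine card_le_card fun x hx => ?_
        obtain ⟨k, -, rfl⟩ := mem_image.mp hx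
        exact mem_filter.mpr ⟨mem_univ _, he k⟩

/-! ### The stub -/

/-- **stub_flatPartitionDistance** (F2; flat-partition distance certificate).  If the word `t : 𝔽₂⁹ → 𝔽₂`
has ODD parity on each of `32` four-dimensional cubes `{b k ⊕ Σ_{εᵢ = 1} u k i | ε ∈ 𝔽₂⁴}` whose points are
pairwise distinct across different `k`, then every cubic `F` differs from `t` in at least `32` points
(`dist(t, RM(3,9)) ≥ 32`).  Proof: a cubic is EVEN on every 4-cube (`stub_cubicEvenOnFourFlat`), so each
cube carries a mismatch (`fp_exists_ne_of_even_odd`); one mismatch per cube and point-disjointness give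
`32` distinct mismatches (`fp_card_le_filter_ne`). -/
theorem stub_flatPartitionDistance :
    ∀ (F t : (Fin (4 + 4 + 1) → Bool) → Bool) (b : Fin 32 → Fin (4 + 4 + 1) → Bool)
      (u : Fin 32 → Fin 4 → Fin (4 + 4 + 1) → Bool),
      IsDegLeFun 3 F →
      (∀ (k k' : Fin 32) (ε ε' : Fin 4 → Bool),
        (fun j => b k j ^^ ((ε 0 && u k 0 j) ^^ (ε 1 && u k 1 j) ^^ (ε 2 && u k 2 j) ^^ (ε 3 && u k 3 j))) =
          (fun j => b k' j ^^ ((ε' 0 && u k' 0 j) ^^ (ε' 1 && u k' 1 j) ^^ (ε' 2 && u k' 2 j) ^^ (ε' 3 && u k' 3 j))) →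
          k = k') →
      (∀ k : Fin 32, Odd ((univ.filter fun ε : Fin 4 → Bool =>
        t (fun j => b k j ^^ ((ε 0 && u k 0 j) ^^ (ε 1 && u k 1 j) ^^ (ε 2 && u k 2 j) ^^ (ε 3 && u k 3 j))) =
          true).card)) →
      32 ≤ (univ.filter fun x : Fin (4 + 4 + 1) → Bool => F x ≠ t x).card := by
  intro F t b u hF hinj hodd
  have h := fp_card_le_filter_ne
    (fun (k : Fin 32) (ε : Fin 4 → Bool) (j : Fin (4 + 4 + 1)) =>
      b k j ^^ ((ε 0 && u k 0 j) ^^ (ε 1 && u k 1 j) ^^ (ε 2 && u k 2 j) ^^ (ε 3 && u k 3 j)))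
    F t hinj fun k => fp_exists_ne_of_even_odd (stub_cubicEvenOnFourFlat F (b k) (u k) hF) (hodd k)
  rwa [Fintype.card_fin] at h

end Summit.QuantumAdvantage.QuantumAdvantage.Theorems.CubicForrelation.NearExactIsExact
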